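import Summits.BirchSwinnertonDyer.Rank1Residual.X11b.Three.ImageSpan
import Literature.NumberTheory.EllipticCurves.BSDSelmerPConverseSerreProofs
import HarnessLib

/-!
# X11b at `p = 3` (team N8/O2), LINE-K sub-target E-K8 · IMG3-GEN (curve level, frame-free):
# if `ρ̄_{E,p}` is onto, every additive endomorphism of `E[p^{k+1}]` acts on Galois-stable
# subgroups of `Hom(C, E[p^{k+1}])` — "Galois-stable ⇒ End-stable" (cell `b2b-bsdres`, team
# `x11b3`, seat p2)

HONEST FRAMING (verbatim, cell `b2b-bsdres`, run/shared/lean/b2b/bsd-rank1-residual/): the goal of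
the cell is to DELETE the COMBINATION-SHAPED residual classes for ALL analytic-rank `≤ 1` curves
over `ℚ` — "full BSD formula for every rank `≤ 1` curve in class `C`" assembled STRICTLY from
published theorems — so that the rank-`≤ 1` remainder becomes exactly the CONSTRUCTION-SHAPED
classes, which are TYPED (missing-input Props), NOT attempted; this is not "finishing BSD".
Research route (team N8/O2: STEP L at `3 ‖ N`, LINE K); ELEMENTARY Galois-module algebra; nothing
booked; no label touched; X11b@3 stays OPEN (RESIDUAL-MAP §I O2). THEOREMS ONLY; no definition;
no named fact; no `sorry`.

## What this file does (E-K8's consumer shape; LINE-K.md ⟦r2 05:57Z⟧ block 3, U2 = McCallum §3 (2))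

`Three/ImageSpan.lean` proves, for matrices, that a subgroup of `GL₂(ℤ/p^{k+1})` with full mod-`p`
image SPANS `M₂(ℤ/p^{k+1})`. Here the frame is hidden: for a Weierstrass curve `W` over a field
`F` with `(p : F) ≠ 0` and `W.HasSurjectiveModNGaloisRep p` (`ρ̄_{E,p} : Γ_F → Aut(E[p])` onto),
and `T = E[p^{k+1}] = W.geomTorsion (p^{k+1})`:

* `WeierstrassCurve.comp_mem_of_forall_galois_comp_mem_of_surj` — for ANY additive group `C` and
  ANY additive subgroup `V ≤ Hom(C, T)` stable under post-composition by the Galois action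
  (`f ↦ (σ • ·) ∘ f`, all `σ ∈ Γ_F`), `V` is stable under post-composition by EVERY additive
  endomorphism `φ : T →+ T`. (Proof: a frame `e : T ≃+ (ℤ/p^{k+1})²`
  (`nonempty_addEquiv_geomTorsion`), its matrix representation `ρ` (`exists_rep_of_addEquiv`),
  full mod-`p` image (`exists_map_eq_of_hasSurjectiveModNGaloisRep`), the matrix of `e ∘ φ ∘ e⁻¹`
  lies in the `ℤ/p^{k+1}`-span of the `ρ σ` (`ImageSpan.span_eq_top_of_forall_exists_map_eq`), and
  span induction.)
* `WeierstrassCurve.map_mem_of_forall_smul_mem_of_surj` — in particular every `Γ_F`-stable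
  additive subgroup `H ≤ E[p^{k+1}]` is stable under every `φ : T →+ T` (so `H` is one of the
  `I · E[p^{k+1}]`, `I` an ideal of `ℤ/p^{k+1}`; at `k = 0`: `E[p]` is an irreducible
  `Γ_F`-module).

Dictionary (McCallum §3 (2), `L = K(E_{p^M})`, `C ≤ H¹(K, E_{p^M})` finite, `V` = image of
`Gal(L_C/L)` in `Hom(C, E_{p^M})`): `V` is `Γ_K`-stable, hence `End(E_{p^M}) ≅ M₂(ℤ/p^M)`-stable,
hence `Y ⊕ Y` after a frame (`Three/MoritaDuality`, `Three/ImageGenerates`), and `Y = Hom(C, ℤ/p^M)`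
by `Duality.eq_top_of_forall_exists_apply_ne_zero` once `H¹(L/K, E_{p^M}) = 0` (U1, Sah — in tree)
shows the common kernel of `Y` is trivial. EVERY prime `p`, any field of characteristic `≠ p`, so
in particular over the quadratic field `K` at `p = 3` (surjectivity of `ρ̄_{E,3}|_{G_K}`:
`Three/ImageAtThreeField`). What this is NOT: no Galois cohomology; no claim about any class;
nothing booked.

References: W. G. McCallum, LMS LNS 153 (1991) §3 [McCallum1991]; J.-P. Serre, Invent. Math. 15
(1972) §IV [Serre1972]; S. Lang, *Algebra* XVII §1 [Lang2002]; team files `cells/x11b3/LINE-K.md`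
block 3 (U2, E-K8).
-/

namespace WeierstrassCurve

open Summit.BirchSwinnertonDyer.Rank1Residual.X11b.Three Literature.NumberTheory.EllipticCurves
open Matrix

universe u

variable {F : Type u} [Field F] (W : WeierstrassCurve F) [W.IsElliptic]

/-- **Galois-stable ⇒ End-stable (E-K8, frame-free).** Let `ρ̄_{E,p}` be onto and
`T = E[p^{k+1}]`. For every additive group `C` and every additive subgroup `V ≤ Hom(C, T)` stable
under `f ↦ (σ • ·) ∘ f` for all `σ ∈ Γ_F`, and every additive endomorphism `φ` of `T`:
`f ∈ V ⇒ φ ∘ f ∈ V`. EVERY prime `p`, every field with `(p : F) ≠ 0`. [folklore] -/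
theorem comp_mem_of_forall_galois_comp_mem_of_surj (p k : ℕ) [Fact p.Prime] (hpF : (p : F) ≠ 0)
    (hsurj : W.HasSurjectiveModNGaloisRep p) {C : Type*} [AddCommGroup C]
    (V : AddSubgroup (C →+ W.geomTorsion ((p ^ (k + 1) : ℕ) : ℤ)))
    (hV : ∀ (σ : Field.absoluteGaloisGroup F), ∀ f ∈ V,
      (DistribSMul.toAddMonoidHom (W.geomTorsion ((p ^ (k + 1) : ℕ) : ℤ)) σ).comp f ∈ V)
    (φ : W.geomTorsion ((p ^ (k + 1) : ℕ) : ℤ) →+ W.geomTorsion ((p ^ (k + 1) : ℕ) : ℤ))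
    (f : C →+ W.geomTorsion ((p ^ (k + 1) : ℕ) : ℤ)) (hf : f ∈ V) : φ.comp f ∈ V := by
  have hp : p.Prime := Fact.out
  haveI : NeZero (p ^ (k + 1)) := ⟨pow_ne_zero _ hp.ne_zero⟩
  -- a frame, its matrix representation, and its full image mod `p`
  obtain ⟨e⟩ := nonempty_addEquiv_geomTorsion W p (k + 1) (Nat.succ_le_succ (Nat.zero_le k)) hpF
  obtain ⟨ρ, hρ⟩ := exists_rep_of_addEquiv W e
  have hfull := exists_map_eq_of_hasSurjectiveModNGaloisRep W p k hpF e ρ hρ hsurj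
  have hspan := ImageSpan.span_eq_top_of_forall_exists_map_eq
    (Set.range fun σ : Field.absoluteGaloisGroup F =>
      (ρ σ : Matrix (Fin 2) (Fin 2) (ZMod (p ^ (k + 1)))))
    (fun t => by obtain ⟨σ, hσ⟩ := hfull t; exact ⟨ρ σ, ⟨σ, rfl⟩, hσ⟩)
  -- the endomorphism attached to a matrix `B` through the frame, `x ↦ e⁻¹ (B *ᵥ e x)`, composed
  -- with `f`; its value at `c`
  have happly : ∀ (B : Matrix (Fin 2) (Fin 2) (ZMod (p ^ (k + 1)))) (c : C),
      (e.symm.toAddMonoidHom.comp ((Matrix.mulVecLin B).toAddMonoidHom.comp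
        (e.toAddMonoidHom.comp f))) c = e.symm (B *ᵥ e (f c)) := fun B c => rfl
  -- every matrix in the `ℤ`-span of the `ρ σ` gives an element of `V`
  have key : ∀ B ∈ Submodule.span ℤ
      (Set.range fun σ : Field.absoluteGaloisGroup F =>
        (ρ σ : Matrix (Fin 2) (Fin 2) (ZMod (p ^ (k + 1))))),
      (e.symm.toAddMonoidHom.comp ((Matrix.mulVecLin B).toAddMonoidHom.comp
        (e.toAddMonoidHom.comp f))) ∈ V := by
    intro B hB
    induction hB using Submodule.span_induction with
    | mem B hB =>
      obtain ⟨σ, rfl⟩ := hB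
      have hmem := hV σ f hf
      convert hmem using 1
      refine AddMonoidHom.ext fun c => ?_
      rw [happly, ← hρ σ (f c), AddEquiv.symm_apply_apply]
      rfl
    | zero =>
      convert V.zero_mem using 1
      refine AddMonoidHom.ext fun c => ?_
      rw [happly, Matrix.zero_mulVec, map_zero, AddMonoidHom.zero_apply]
    | add B B' _ _ hB hB' =>
      convert V.add_mem hB hB' using 1
      refine AddMonoidHom.ext fun c => ?_
      rw [AddMonoidHom.add_apply, happly, happly, happly, Matrix.add_mulVec, map_add]
    | smul n B _ hB =>
      convert V.zsmul_mem hB n using 1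
      refine AddMonoidHom.ext fun c => ?_
      rw [AddMonoidHom.zsmul_apply, happly, happly, Matrix.smul_mulVec, map_zsmul]
  -- the matrix of `e ∘ φ ∘ e⁻¹` lies in that span (`ImageSpan`: the `ρ σ` span everything)
  let φ' : (Fin 2 → ZMod (p ^ (k + 1))) →ₗ[ZMod (p ^ (k + 1))] (Fin 2 → ZMod (p ^ (k + 1))) :=
    (e.toAddMonoidHom.comp (φ.comp e.symm.toAddMonoidHom)).toZModLinearMap (p ^ (k + 1))
  have hA : ∀ x, e (φ x) = LinearMap.toMatrix' φ' *ᵥ e x := by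
    intro x
    rw [← Matrix.toLin'_apply, Matrix.toLin'_toMatrix']
    change e (φ x) = e (φ (e.symm (e x)))
    rw [AddEquiv.symm_apply_apply]
  have hAZ : LinearMap.toMatrix' φ' ∈ Submodule.span ℤ
      (Set.range fun σ : Field.absoluteGaloisGroup F =>
        (ρ σ : Matrix (Fin 2) (Fin 2) (ZMod (p ^ (k + 1))))) := by
    rw [← Submodule.restrictScalars_span ℤ (ZMod (p ^ (k + 1)))
      (ZMod.ringHom_surjective (algebraMap ℤ (ZMod (p ^ (k + 1))))) _,
      Submodule.restrictScalars_mem, hspan]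
    exact Submodule.mem_top
  have hmem := key (LinearMap.toMatrix' φ') hAZ
  convert hmem using 1
  refine AddMonoidHom.ext fun c => ?_
  rw [happly, ← hA, AddEquiv.symm_apply_apply]
  rfl

/-- **Galois-stable subgroups of `E[p^{k+1}]` are End-stable** when `ρ̄_{E,p}` is onto: every
additive subgroup `H ≤ E[p^{k+1}]` with `σ • H ⊆ H` for all `σ ∈ Γ_F` satisfies `φ(H) ⊆ H` for
every additive endomorphism `φ` of `E[p^{k+1}]` (so `H = I · E[p^{k+1}]` for an ideal `I` of
`ℤ/p^{k+1}`; at `k = 0`, `E[p]` is an irreducible `Γ_F`-module). EVERY prime `p`, every field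
with `(p : F) ≠ 0`. [folklore] -/
theorem map_mem_of_forall_smul_mem_of_surj (p k : ℕ) [Fact p.Prime] (hpF : (p : F) ≠ 0)
    (hsurj : W.HasSurjectiveModNGaloisRep p)
    (H : AddSubgroup (W.geomTorsion ((p ^ (k + 1) : ℕ) : ℤ)))
    (hH : ∀ (σ : Field.absoluteGaloisGroup F), ∀ x ∈ H, σ • x ∈ H)
    (φ : W.geomTorsion ((p ^ (k + 1) : ℕ) : ℤ) →+ W.geomTorsion ((p ^ (k + 1) : ℕ) : ℤ))
    (x : W.geomTorsion ((p ^ (k + 1) : ℕ) : ℤ)) (hx : x ∈ H) : φ x ∈ H := by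
  -- apply the `Hom` form with `C = ℤ`, `V = {f | f 1 ∈ H}` and `f = (n ↦ n • x)`
  let V : AddSubgroup (ℤ →+ W.geomTorsion ((p ^ (k + 1) : ℕ) : ℤ)) :=
    { carrier := {f | f 1 ∈ H}
      add_mem' := fun {f g} hf hg => by
        change f 1 + g 1 ∈ H
        exact H.add_mem hf hg
      zero_mem' := H.zero_mem
      neg_mem' := fun {f} hf => by
        change -(f 1) ∈ H
        exact H.neg_mem hf }
  have hV : ∀ (σ : Field.absoluteGaloisGroup F), ∀ f ∈ V,
      (DistribSMul.toAddMonoidHom (W.geomTorsion ((p ^ (k + 1) : ℕ) : ℤ)) σ).comp f ∈ V :=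
    fun σ f hf => hH σ (f 1) hf
  have hx' : zmultiplesHom (W.geomTorsion ((p ^ (k + 1) : ℕ) : ℤ)) x ∈ V := by
    change zmultiplesHom (W.geomTorsion ((p ^ (k + 1) : ℕ) : ℤ)) x 1 ∈ H
    rwa [zmultiplesHom_apply, one_zsmul]
  have h := W.comp_mem_of_forall_galois_comp_mem_of_surj p k hpF hsurj V hV φ _ hx'
  change φ (zmultiplesHom (W.geomTorsion ((p ^ (k + 1) : ℕ) : ℤ)) x 1) ∈ H at h
  rwa [zmultiplesHom_apply, one_zsmul] at h

end WeierstrassCurve
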